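import Literature.AlgebraicGeometry.Milne1999.LefschetzGroupProductsRestriction
import Literature.AlgebraicGeometry.Milne1999.LefschetzGroupCMProducts
import Literature.AlgebraicGeometry.Milne1999.LefschetzCentraliserBiproducts
import HarnessLib

/-!
# `(L(A), l(A)) ≅ ∏ᵢ (L(Aᵢ), l(Aᵢ))` on the family carriers for a finite product of pairwise Hom-orthogonal factors,
# its isogeny invariance, and Milne 1999b Thm. 2.6 on `ℂ`-points: `L(⨁ A_Ψ)(ℂ) ≅ (∏_Ψ (ℂˣ)^{Φ_Ψ}) × ℂˣ` for CM types

Family `hodge`, layer `Literature/AlgebraicGeometry/Milne1999`, namespace `Literature.AlgebraicGeometry.Milne1999`.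
THEOREMS ONLY (no definition, no named fact; D-0026 net debt 0).  Sequel of `Milne1999/LefschetzGroupProductsRestriction`
(the binary step: torus coordinates with character multiply) and `Milne1999/LefschetzGroupCMProducts` (the CM coordinates
`L(A)(ℂ) ≃* (Φ → ℂˣ) × ℂˣ` with last coordinate Milne's `l`).

Milne [Milne1999LefschetzClasses, §4 p. 658 and Cor. 4.7]: «the algebraic group `L(A)` […] depends only on the isogeny class
of `A`»; «an isogeny `A → A₁^{r₁} × ⋯ × A_s^{r_s}` with the `Aᵢ` simple and pairwise nonisogenous defines an isomorphism
`(L(A), l(A)) → ∏ᵢ (L(Aᵢ), l(Aᵢ))`» (the product of Def. 4.6, fibred over the characters).  Milne [Milne1999, §2 Thm. 2.6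
and its proof]: «the fundamental group of `LCM^K(ℂ)` is `∏_Ψ (T^Ψ, t^Ψ)`», «`(T^K, t^K) = (L(∏ A_Ψ), l(∏ A_Ψ)) =
∏ (L(A_Ψ), l(A_Ψ)) = ∏ (T^Ψ, t^Ψ)`» (finite `K`), with Prop. 2.5 `(L(A_Ψ), l(A_Ψ)) = (T^Ψ, t^Ψ)`.

Throughout, «TORUS COORDINATES WITH CHARACTER» on `L(Z)(ℂ)` means a group isomorphism `e : L(Z)(ℂ) ≃* T × ℂˣ` whose last
coordinate is `1` on `ker l(Z)` and `c²` at `w(c)` — i.e. IS Milne's character `l` (`L = w(𝔾_m) · ker l`; then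
`e(g)₂ = 1 ⟺ g ∈ ker l` and `Q_h(g₁x, g₁y) = e(g)₂ Q_h(x, y)` for every polarization class,
`Milne1999/LefschetzGroupProductsRestriction`).  Spelled out in each statement (no definition is introduced).

* §1 **ISOGENY INVARIANCE WITH THE CHARACTER**: along an isogeny `f : A → B` there is `e : L(B)(ℂ) ≃* L(A)(ℂ)` with
  `(e g)₁ = f^* g₁ (f^*)⁻¹`, `e(g) ∈ ker l(A) ⟺ g ∈ ker l(B)`, `e(w(c)) = w(c)` (`exists_lefschetzGroup_mulEquiv_of_isIsogeny`);
  torus coordinates with character pass along isogenies in both directions (`…_of_isIsogeny_of_mulEquiv`, `…'`,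
  `…_of_isIsogenous_of_mulEquiv`).
* §2 **FINITE PRODUCTS** (`A : Fin (n+1) → AbelianVariety ℂ` pairwise Hom-orthogonal, positive-dimensional): torus
  coordinates with character `L(Aᵢ)(ℂ) ≃* Tᵢ × ℂˣ` on the factors give `L(⨁ Aᵢ)(ℂ) ≃* (∏ᵢ Tᵢ) × ℂˣ` with character
  (`exists_lefschetzGroup_biproduct_mulEquiv_of_forall`, induction along `⨁_{n+1} A ≅ A₀ × ⨁_n A_{i+1}`), and then
  `ker l(⨁ Aᵢ)(ℂ) ≃* ∏ᵢ Tᵢ` (`exists_specialLefschetzGroup_mulEquiv_of_mulEquiv`).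
* §3 **MILNE 1999b THM. 2.6 ON `ℂ`-POINTS**: for pairwise Hom-orthogonal realisations `Aᵢ` of CM types `(Kᵢ; Φᵢ)`
  (`θᵢ(Kᵢ) ⊆ C(Aᵢ)`; e.g. pairwise non-isogenous simple CM abelian varieties):
  **`L(⨁ Aᵢ)(ℂ) ≃* (∏ᵢ (Φᵢ → ℂˣ)) × ℂˣ`** with last coordinate the character
  (`exists_lefschetzGroup_biproduct_mulEquiv_pi_pi_units_prod`), **`ker l(⨁ Aᵢ)(ℂ) ≃* ∏ᵢ (Φᵢ → ℂˣ)`**, the same for every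
  `X ∼ ⨁ Aᵢ`, commutativity, and «`L ⊃ Hg`»: `MT(X)(ℂ)` embeds in the torus and fills it iff `X` is stably nondegenerate.

## References

* [Milne1999LefschetzClasses] J. S. Milne, *Lefschetz classes on abelian varieties*, Duke Math. J. 96 (1999): §1 p. 643,
  Prop. 1.5 (p. 644), §4 p. 658, Def. 4.6, Cor. 4.7, Prop. 4.8 (p. 660), p. 659.
* [Milne1999] J. S. Milne, *Lefschetz motives and the Tate conjecture*, Compositio Math. 117 (1999): §2 Prop. 2.5, Thm. 2.6, A.7.
* [MumfordAV1970] D. Mumford, *Abelian varieties* (1970), §19 Cor. 2 of Thm. 1 (p. 174).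
* [Gordon1999HodgeAVSurvey] B. B. Gordon, *A survey of the Hodge conjecture for abelian varieties* (1999), Thm. 7.5, Def. 7.6.
-/

noncomputable section

universe u

open CategoryTheory CategoryTheory.Limits NumberField
open Literature.AlgebraicTopology.SingularHomology
open Literature.AlgebraicGeometry.HodgeTheory
open Literature.AlgebraicGeometry.Motives
open Literature.AlgebraicGeometry.ComplexMultiplication (IsCMTypeRealisation)

namespace Literature.AlgebraicGeometry.Milne1999

/-! ### §0 Bookkeeping -/

section Bookkeeping

variable {Z : AbelianVariety ℂ}

/-- `w(c)₁ = c · id`. [folklore] -/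
private theorem weightCocharacter_one_eq_smulOfUnit (Z : AbelianVariety ℂ) (c : ℂˣ) :
    weightCocharacter Z.X c 1 = LinearEquiv.smulOfUnit c := by
  rw [show weightCocharacter Z.X c 1 = LinearEquiv.smulOfUnit (c ^ 1) from rfl, pow_one]

/-- `g ∈ ker l(Z)` iff `g₁ ∈ ker l(Z)|_{H¹}`, for `g ∈ L(Z)` (an element of `L` is determined by its `H¹`-component).
[cite: Milne1999LefschetzClasses, Def. 4.3 and Thm. 4.4 (p. 659)] -/
private theorem mem_specialLefschetzGroup_iff_apply_one_mem {g : ∀ k : ℕ, complexBetti Z.X k ≃ₗ[ℂ] complexBetti Z.X k}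
    (hg : g ∈ lefschetzGroup Z.dim Z.X) :
    g ∈ specialLefschetzGroup Z.dim Z.X ↔
      g 1 ∈ (specialLefschetzGroup Z.dim Z.X).map
        (Pi.evalMonoidHom (fun k : ℕ ↦ complexBetti Z.X k ≃ₗ[ℂ] complexBetti Z.X k) 1) := by
  refine ⟨fun h ↦ ⟨g, h, rfl⟩, ?_⟩
  rintro ⟨s, hs, hs1⟩
  have e : s = g := lefschetzGroup_ext_one' (specialLefschetzGroup_le_lefschetzGroup hs) hg hs1
  exact e ▸ hs

/-- **`ker l(Z)(ℂ) ≃* T` from torus coordinates with character `L(Z)(ℂ) ≃* T × ℂˣ`** (`dim Z ≥ 1`): `ker l` is exactly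
`{last coordinate = 1}` (`snd_eq_one_iff_mem_specialLefschetzGroup_of_mulEquiv`), which projects isomorphically onto `T`.
[cite: Milne1999LefschetzClasses, §4 p. 659 (ker l = S(A))] -/
theorem exists_specialLefschetzGroup_mulEquiv_of_mulEquiv {T : Type*} [Group T] (hZ : 1 ≤ Z.dim)
    (eZ : lefschetzGroup Z.dim Z.X ≃* T × ℂˣ)
    (he1 : ∀ s : lefschetzGroup Z.dim Z.X, s.1 ∈ specialLefschetzGroup Z.dim Z.X → (eZ s).2 = 1)
    (he2 : ∀ c : ℂˣ, (eZ ⟨weightCocharacter Z.X c, weightCocharacter_mem_lefschetzGroup c⟩).2 = c ^ 2) :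
    ∃ e : specialLefschetzGroup Z.dim Z.X ≃* T,
      ∀ s : specialLefschetzGroup Z.dim Z.X, e s = (eZ ⟨s.1, specialLefschetzGroup_le_lefschetzGroup s.2⟩).1 := by
  let F : specialLefschetzGroup Z.dim Z.X →* T :=
    (MonoidHom.fst T ℂˣ).comp (eZ.toMonoidHom.comp (Subgroup.inclusion specialLefschetzGroup_le_lefschetzGroup))
  have hF : ∀ s, F s = (eZ ⟨s.1, specialLefschetzGroup_le_lefschetzGroup s.2⟩).1 := fun _ ↦ rfl
  refine ⟨MulEquiv.ofBijective F ⟨fun s s' h ↦ ?_, fun t ↦ ?_⟩, hF⟩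
  · rw [hF, hF] at h
    have h2 : (eZ ⟨s.1, specialLefschetzGroup_le_lefschetzGroup s.2⟩).2 =
        (eZ ⟨s'.1, specialLefschetzGroup_le_lefschetzGroup s'.2⟩).2 := by rw [he1 _ s.2, he1 _ s'.2]
    have e := eZ.injective (Prod.ext h h2)
    exact Subtype.ext (congrArg (fun x : lefschetzGroup Z.dim Z.X ↦ x.1) e)
  · have hmem : (eZ.symm (t, 1)).1 ∈ specialLefschetzGroup Z.dim Z.X :=
      (snd_eq_one_iff_mem_specialLefschetzGroup_of_mulEquiv hZ eZ he1 he2 _).1 (by rw [MulEquiv.apply_symm_apply])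
    refine ⟨⟨(eZ.symm (t, 1)).1, hmem⟩, ?_⟩
    rw [hF]
    have e : (⟨(eZ.symm (t, 1)).1, specialLefschetzGroup_le_lefschetzGroup hmem⟩ : lefschetzGroup Z.dim Z.X) =
        eZ.symm (t, 1) := Subtype.ext rfl
    rw [e, MulEquiv.apply_symm_apply]

end Bookkeeping

/-! ### §1 Isogeny invariance of `(L, l)` on the family carriers -/

section Isogeny

variable {A B : AbelianVariety ℂ} {f : A ⟶ B}

/-- **`(L(B), l) ≅ (L(A), l)` along an isogeny `f : A → B`, EXPLICITLY**: a group isomorphism `e : L(B)(ℂ) ≃* L(A)(ℂ)` with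
`(e g)₁ = f^* g₁ (f^*)⁻¹` (Milne's `γ ↦ V(α) γ V(α)⁻¹`), `e(g) ∈ ker l(A) ⟺ g ∈ ker l(B)` and `e(w(c)) = w(c)` — so `e`
preserves the character («`L(A)` […] depends only on the isogeny class», with its `l`).
[cite: Milne1999LefschetzClasses, §1 pp. 643–644, §4 p. 658 and p. 659] -/
theorem exists_lefschetzGroup_mulEquiv_of_isIsogeny (hf : AbelianVariety.IsIsogeny f) :
    ∃ e : lefschetzGroup B.dim B.X ≃* lefschetzGroup A.dim A.X,
      (∀ g : lefschetzGroup B.dim B.X, (e g).1 1 = isogenyConj hf (g.1 1)) ∧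
      (∀ g : lefschetzGroup B.dim B.X,
        (e g).1 ∈ specialLefschetzGroup A.dim A.X ↔ g.1 ∈ specialLefschetzGroup B.dim B.X) ∧
      ∀ c : ℂˣ, e ⟨weightCocharacter B.X c, weightCocharacter_mem_lefschetzGroup c⟩ =
        ⟨weightCocharacter A.X c, weightCocharacter_mem_lefschetzGroup c⟩ := by
  let EB := MulEquiv.ofBijective _ (bijective_evalOne_subgroupMap_lefschetzGroup' B)
  let EA := MulEquiv.ofBijective _ (bijective_evalOne_subgroupMap_lefschetzGroup' A)
  let e₁ : (lefschetzGroup B.dim B.X).map (Pi.evalMonoidHom (fun k : ℕ ↦ complexBetti B.X k ≃ₗ[ℂ] complexBetti B.X k) 1) ≃*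
      (lefschetzGroup A.dim A.X).map (Pi.evalMonoidHom (fun k : ℕ ↦ complexBetti A.X k ≃ₗ[ℂ] complexBetti A.X k) 1) :=
    ((isogenyConj hf).subgroupMap _).trans (MulEquiv.subgroupCongr (lefschetzGroup_map_one_map_isogenyConj hf))
  let e := EB.trans (e₁.trans EA.symm)
  have he : ∀ g : lefschetzGroup B.dim B.X, (e g).1 1 = isogenyConj hf (g.1 1) := fun g ↦
    congrArg Subtype.val (EA.apply_symm_apply (e₁ (EB g)))
  refine ⟨e, he, fun g ↦ ?_, fun c ↦ ?_⟩
  · rw [mem_specialLefschetzGroup_iff_apply_one_mem (e g).2, he, isogenyConj_mem_map_specialLefschetzGroup_one_iff hf,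
      ← mem_specialLefschetzGroup_iff_apply_one_mem g.2]
  · refine Subtype.ext (lefschetzGroup_ext_one' (e _).2 (weightCocharacter_mem_lefschetzGroup c) ?_)
    rw [he]
    show isogenyConj hf (weightCocharacter B.X c 1) = weightCocharacter A.X c 1
    rw [weightCocharacter_one_eq_smulOfUnit B, weightCocharacter_one_eq_smulOfUnit A, isogenyConj_smulOfUnit]

/-- **Torus coordinates with character descend along an isogeny `f : A → B` from `B` to `A`**: `L(B)(ℂ) ≃* T × ℂˣ` with
last coordinate the character gives `L(A)(ℂ) ≃* T × ℂˣ` with last coordinate the character. [cite: Milne1999LefschetzClasses, §4 p. 658 and Cor. 4.7] -/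
theorem exists_lefschetzGroup_mulEquiv_of_isIsogeny_of_mulEquiv (hf : AbelianVariety.IsIsogeny f) {T : Type*} [Group T]
    (eB : lefschetzGroup B.dim B.X ≃* T × ℂˣ)
    (h1 : ∀ s : lefschetzGroup B.dim B.X, s.1 ∈ specialLefschetzGroup B.dim B.X → (eB s).2 = 1)
    (h2 : ∀ c : ℂˣ, (eB ⟨weightCocharacter B.X c, weightCocharacter_mem_lefschetzGroup c⟩).2 = c ^ 2) :
    ∃ eA : lefschetzGroup A.dim A.X ≃* T × ℂˣ,
      (∀ s : lefschetzGroup A.dim A.X, s.1 ∈ specialLefschetzGroup A.dim A.X → (eA s).2 = 1) ∧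
      ∀ c : ℂˣ, (eA ⟨weightCocharacter A.X c, weightCocharacter_mem_lefschetzGroup c⟩).2 = c ^ 2 := by
  obtain ⟨e, -, hker, hw⟩ := exists_lefschetzGroup_mulEquiv_of_isIsogeny hf
  refine ⟨e.symm.trans eB, fun s hs ↦ ?_, fun c ↦ ?_⟩
  · rw [MulEquiv.trans_apply]
    refine h1 _ ((hker (e.symm s)).1 ?_)
    rw [MulEquiv.apply_symm_apply]
    exact hs
  · rw [MulEquiv.trans_apply, ← hw c, MulEquiv.symm_apply_apply, h2]

/-- **Torus coordinates with character pass along an isogeny `f : A → B` from `A` to `B`.** [cite: Milne1999LefschetzClasses, §4 p. 658 and Cor. 4.7] -/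
theorem exists_lefschetzGroup_mulEquiv_of_isIsogeny_of_mulEquiv' (hf : AbelianVariety.IsIsogeny f) {T : Type*} [Group T]
    (eA : lefschetzGroup A.dim A.X ≃* T × ℂˣ)
    (h1 : ∀ s : lefschetzGroup A.dim A.X, s.1 ∈ specialLefschetzGroup A.dim A.X → (eA s).2 = 1)
    (h2 : ∀ c : ℂˣ, (eA ⟨weightCocharacter A.X c, weightCocharacter_mem_lefschetzGroup c⟩).2 = c ^ 2) :
    ∃ eB : lefschetzGroup B.dim B.X ≃* T × ℂˣ,
      (∀ s : lefschetzGroup B.dim B.X, s.1 ∈ specialLefschetzGroup B.dim B.X → (eB s).2 = 1) ∧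
      ∀ c : ℂˣ, (eB ⟨weightCocharacter B.X c, weightCocharacter_mem_lefschetzGroup c⟩).2 = c ^ 2 := by
  obtain ⟨e, -, hker, hw⟩ := exists_lefschetzGroup_mulEquiv_of_isIsogeny hf
  refine ⟨e.trans eA, fun s hs ↦ ?_, fun c ↦ ?_⟩
  · rw [MulEquiv.trans_apply]
    exact h1 _ ((hker s).2 hs)
  · rw [MulEquiv.trans_apply, hw c, h2]

/-- **Torus coordinates with character on isogenous abelian varieties** (`A ∼ B`, either direction).
[cite: Milne1999LefschetzClasses, §4 p. 658 («L(A) depends only on the isogeny class of A»)] -/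
theorem exists_lefschetzGroup_mulEquiv_of_isIsogenous_of_mulEquiv (hAB : AbelianVariety.IsIsogenous A B) {T : Type*} [Group T]
    (eB : lefschetzGroup B.dim B.X ≃* T × ℂˣ)
    (h1 : ∀ s : lefschetzGroup B.dim B.X, s.1 ∈ specialLefschetzGroup B.dim B.X → (eB s).2 = 1)
    (h2 : ∀ c : ℂˣ, (eB ⟨weightCocharacter B.X c, weightCocharacter_mem_lefschetzGroup c⟩).2 = c ^ 2) :
    ∃ eA : lefschetzGroup A.dim A.X ≃* T × ℂˣ,
      (∀ s : lefschetzGroup A.dim A.X, s.1 ∈ specialLefschetzGroup A.dim A.X → (eA s).2 = 1) ∧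
      ∀ c : ℂˣ, (eA ⟨weightCocharacter A.X c, weightCocharacter_mem_lefschetzGroup c⟩).2 = c ^ 2 := by
  obtain ⟨f, hf⟩ := hAB
  exact exists_lefschetzGroup_mulEquiv_of_isIsogeny_of_mulEquiv hf eB h1 h2

/-- **`(L(A), l) ≅ (L(A^{r+1}), l)` EXPLICITLY: `g ↦` the element acting by `g₁^{⊕(r+1)}` on `H¹(A^{r+1})`** (`dim A ≥ 1`;
Prop. 1.5 / Cor. 4.7 for a power, «the diagonal action of `C(A)` on `rV(A)`»), with `ker l ↔ ker l` and `w(c) ↦ w(c)` — the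
character is preserved. [cite: Milne1999LefschetzClasses, §1 p. 643, Prop. 1.5 (p. 644), Cor. 4.7 (p. 660) and p. 659] -/
theorem exists_lefschetzGroup_powSucc_mulEquiv {A : AbelianVariety ℂ} (hA : 1 ≤ A.dim) (r : ℕ) :
    ∃ e : lefschetzGroup A.dim A.X ≃* lefschetzGroup (A.powSucc r).dim (A.powSucc r).X,
      (∀ g : lefschetzGroup A.dim A.X, (e g).1 1 = diagPow A (g.1 1) r) ∧
      (∀ g : lefschetzGroup A.dim A.X,
        (e g).1 ∈ specialLefschetzGroup (A.powSucc r).dim (A.powSucc r).X ↔ g.1 ∈ specialLefschetzGroup A.dim A.X) ∧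
      ∀ c : ℂˣ, e ⟨weightCocharacter A.X c, weightCocharacter_mem_lefschetzGroup c⟩ =
        ⟨weightCocharacter (A.powSucc r).X c, weightCocharacter_mem_lefschetzGroup c⟩ := by
  let D : (complexBetti A.X 1 ≃ₗ[ℂ] complexBetti A.X 1) →*
      (complexBetti (A.powSucc r).X 1 ≃ₗ[ℂ] complexBetti (A.powSucc r).X 1) :=
    { toFun := fun u ↦ diagPow A u r
      map_one' := diagPow_one r
      map_mul' := fun u v ↦ diagPow_mul u v r }
  have hD : ((lefschetzGroup A.dim A.X).map
      (Pi.evalMonoidHom (fun k : ℕ ↦ complexBetti A.X k ≃ₗ[ℂ] complexBetti A.X k) 1)).map D =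
      (lefschetzGroup (A.powSucc r).dim (A.powSucc r).X).map
        (Pi.evalMonoidHom (fun k : ℕ ↦ complexBetti (A.powSucc r).X k ≃ₗ[ℂ] complexBetti (A.powSucc r).X k) 1) := by
    ext U
    rw [Subgroup.mem_map, mem_map_lefschetzGroup_one_powSucc_iff A hA r U]
    rfl
  have hinj : Function.Injective (D.subgroupMap ((lefschetzGroup A.dim A.X).map
      (Pi.evalMonoidHom (fun k : ℕ ↦ complexBetti A.X k ≃ₗ[ℂ] complexBetti A.X k) 1))) := by
    rintro ⟨u, hu⟩ ⟨v, hv⟩ e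
    exact Subtype.ext (diagPow_injective (A := A) r (congrArg Subtype.val e))
  let e₁ := (MulEquiv.ofBijective _ ⟨hinj, MonoidHom.subgroupMap_surjective _ _⟩).trans (MulEquiv.subgroupCongr hD)
  let EA := MulEquiv.ofBijective _ (bijective_evalOne_subgroupMap_lefschetzGroup' A)
  let EP := MulEquiv.ofBijective _ (bijective_evalOne_subgroupMap_lefschetzGroup' (A.powSucc r))
  let e := EA.trans (e₁.trans EP.symm)
  have he : ∀ g : lefschetzGroup A.dim A.X, (e g).1 1 = diagPow A (g.1 1) r := fun g ↦
    congrArg Subtype.val (EP.apply_symm_apply (e₁ (EA g)))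
  refine ⟨e, he, fun g ↦ ?_, fun c ↦ ?_⟩
  · rw [mem_specialLefschetzGroup_iff_apply_one_mem (e g).2, he,
      diagPow_mem_map_specialLefschetzGroup_one_powSucc_iff hA r, ← mem_specialLefschetzGroup_iff_apply_one_mem g.2]
  · refine Subtype.ext (lefschetzGroup_ext_one' (e _).2 (weightCocharacter_mem_lefschetzGroup c) ?_)
    rw [he]
    show diagPow A (weightCocharacter A.X c 1) r = weightCocharacter (A.powSucc r).X c 1
    rw [weightCocharacter_one_eq_smulOfUnit A, weightCocharacter_one_eq_smulOfUnit (A.powSucc r), diagPow_smulOfUnit]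

/-- **Torus coordinates with character pass to the powers `A^{r+1}`** (`dim A ≥ 1`; «`S(A) = S(A^r)`», Cor. 4.7).
[cite: Milne1999LefschetzClasses, Prop. 1.5 (p. 644) and Cor. 4.7 (p. 660)] -/
theorem exists_lefschetzGroup_powSucc_mulEquiv_of_mulEquiv {A : AbelianVariety ℂ} (hA : 1 ≤ A.dim) (r : ℕ) {T : Type*}
    [Group T] (eA : lefschetzGroup A.dim A.X ≃* T × ℂˣ)
    (h1 : ∀ s : lefschetzGroup A.dim A.X, s.1 ∈ specialLefschetzGroup A.dim A.X → (eA s).2 = 1)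
    (h2 : ∀ c : ℂˣ, (eA ⟨weightCocharacter A.X c, weightCocharacter_mem_lefschetzGroup c⟩).2 = c ^ 2) :
    ∃ eP : lefschetzGroup (A.powSucc r).dim (A.powSucc r).X ≃* T × ℂˣ,
      (∀ s : lefschetzGroup (A.powSucc r).dim (A.powSucc r).X,
        s.1 ∈ specialLefschetzGroup (A.powSucc r).dim (A.powSucc r).X → (eP s).2 = 1) ∧
      ∀ c : ℂˣ, (eP ⟨weightCocharacter (A.powSucc r).X c, weightCocharacter_mem_lefschetzGroup c⟩).2 = c ^ 2 := by
  obtain ⟨e, -, hker, hw⟩ := exists_lefschetzGroup_powSucc_mulEquiv hA r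
  refine ⟨e.symm.trans eA, fun s hs ↦ ?_, fun c ↦ ?_⟩
  · rw [MulEquiv.trans_apply]
    refine h1 _ ((hker (e.symm s)).1 ?_)
    rw [MulEquiv.apply_symm_apply]
    exact hs
  · rw [MulEquiv.trans_apply, ← hw c, MulEquiv.symm_apply_apply, h2]

end Isogeny

/-! ### §2 Finite products of pairwise Hom-orthogonal factors: `(L(⨁ Aᵢ), l) ≅ ∏ᵢ (L(Aᵢ), l)` in torus coordinates -/

section Biproduct

variable {n : ℕ}

/-- `dim ⨁ Aᵢ ≥ 1` when `dim A₀ ≥ 1` (`⨁_{n+1} A ≅ A₀ × ⨁_n A_{i+1}`). [cite: MumfordAV1970, §19] -/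
private theorem one_le_dim_biproduct (A : Fin (n + 1) → AbelianVariety ℂ) (h0 : 1 ≤ (A 0).dim) : 1 ≤ (⨁ A).dim := by
  rw [AbelianVariety.dim_eq_of_isIsogeny (isIsogeny_biproductSuccSplit A), AbelianVariety.dim_prod]
  omega

/-- **`(L(⨁ Aᵢ), l) ≅ ∏ᵢ (L(Aᵢ), l)` IN TORUS COORDINATES** (Cor. 4.7 for pairwise Hom-orthogonal positive-dimensional factors
`A₀, …, A_n`, family carriers, multiplicity one): torus coordinates with character `L(Aᵢ)(ℂ) ≃* Tᵢ × ℂˣ` on the factors give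
`L(⨁ Aᵢ)(ℂ) ≃* (∏ᵢ Tᵢ) × ℂˣ` with last coordinate the character — the fibre product `∏ (Tᵢ × 𝔾_m, pr₂)` of Def. 4.6.
Induction along the isogeny `⨁_{n+1} A → A₀ × ⨁_n A_{i+1}` (`biproductSuccSplit`), the binary step
`exists_lefschetzGroup_prod_mulEquiv_of_mulEquiv'` and §1. [cite: Milne1999LefschetzClasses, Def. 4.6, Cor. 4.7 (p. 660), Prop. 1.5]
[cite: Milne1999, §2 Thm. 2.6 (proof: (L(∏ A_Ψ), l) = ∏ (L(A_Ψ), l))] -/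
theorem exists_lefschetzGroup_biproduct_mulEquiv_of_forall :
    ∀ {n : ℕ} (A : Fin (n + 1) → AbelianVariety ℂ) (T : Fin (n + 1) → Type u) [∀ i, Group (T i)],
      (∀ i j, i ≠ j → ∀ f : A i ⟶ A j, f = 0) → (∀ i, 1 ≤ (A i).dim) →
      (∀ i, ∃ e : lefschetzGroup (A i).dim (A i).X ≃* T i × ℂˣ,
        (∀ s : lefschetzGroup (A i).dim (A i).X, s.1 ∈ specialLefschetzGroup (A i).dim (A i).X → (e s).2 = 1) ∧
        ∀ c : ℂˣ, (e ⟨weightCocharacter (A i).X c, weightCocharacter_mem_lefschetzGroup c⟩).2 = c ^ 2) →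
      ∃ e : lefschetzGroup (⨁ A).dim (⨁ A).X ≃* (∀ i, T i) × ℂˣ,
        (∀ s : lefschetzGroup (⨁ A).dim (⨁ A).X, s.1 ∈ specialLefschetzGroup (⨁ A).dim (⨁ A).X → (e s).2 = 1) ∧
        ∀ c : ℂˣ, (e ⟨weightCocharacter (⨁ A).X c, weightCocharacter_mem_lefschetzGroup c⟩).2 = c ^ 2
  | 0, A, T, _, _, _, hcoord => by
    obtain ⟨e0, he1, he2⟩ := hcoord 0
    obtain ⟨e, h1', h2'⟩ :=
      exists_lefschetzGroup_mulEquiv_of_isIsogeny_of_mulEquiv (isIsogeny_biproduct_π_fin_one A) e0 he1 he2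
    -- `T 0 ≃* T 0 × (Π over Fin 0) ≃* Π over Fin 1`
    let κ : (T 0 × (∀ i : Fin 0, T i.succ)) ≃* (∀ i, T i) :=
      MulEquiv.mk' (Fin.consEquiv T) fun x y ↦ by
        funext i
        refine Fin.cases ?_ (fun j ↦ ?_) i <;> simp [Fin.consEquiv]
    let κ₀ : T 0 ≃* (∀ i, T i) := (MulEquiv.prodUnique.symm : T 0 ≃* T 0 × (∀ i : Fin 0, T i.succ)).trans κ
    refine ⟨e.trans (MulEquiv.prodCongr κ₀ (MulEquiv.refl ℂˣ)), fun s hs ↦ ?_, fun c ↦ ?_⟩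
    · exact h1' s hs
    · exact h2' c
  | n + 1, A, T, _, hOrth, h1, hcoord => by
    -- the tail `⨁_{i < n+1} A_{i+1}` by induction, the head `A₀`, the binary step, the isogeny `⨁ A → A₀ × ⨁ tail`
    obtain ⟨eT, hT1, hT2⟩ := exists_lefschetzGroup_biproduct_mulEquiv_of_forall (fun i : Fin (n + 1) ↦ A i.succ)
      (fun i ↦ T i.succ) (fun i j hij ↦ hOrth i.succ j.succ fun e ↦ hij (Fin.succ_inj.1 e)) (fun i ↦ h1 _)
      (fun i ↦ hcoord _)
    obtain ⟨e0, he1, he2⟩ := hcoord 0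
    obtain ⟨eP, hP1, hP2⟩ := exists_lefschetzGroup_prod_mulEquiv_of_mulEquiv' (hom_to_biproduct_succ_eq_zero hOrth)
      (hom_from_biproduct_succ_eq_zero hOrth) (h1 0) (one_le_dim_biproduct _ (h1 _)) e0 eT he1 he2 hT1 hT2
    obtain ⟨e, h1', h2'⟩ :=
      exists_lefschetzGroup_mulEquiv_of_isIsogeny_of_mulEquiv (isIsogeny_biproductSuccSplit A) eP hP1 hP2
    let κ : (T 0 × (∀ i : Fin (n + 1), T i.succ)) ≃* (∀ i, T i) :=
      MulEquiv.mk' (Fin.consEquiv T) fun x y ↦ by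
        funext i
        refine Fin.cases ?_ (fun j ↦ ?_) i <;> simp [Fin.consEquiv]
    refine ⟨e.trans (MulEquiv.prodCongr κ (MulEquiv.refl ℂˣ)), fun s hs ↦ ?_, fun c ↦ ?_⟩
    · exact h1' s hs
    · exact h2' c

/-- **The same for every `X` isogenous to `⨁ Aᵢ`** (Cor. 4.7: «an isogeny `A → A₁ × ⋯ × A_s` […] defines an isomorphism
`(L(A), l(A)) → ∏ᵢ (L(Aᵢ), l(Aᵢ))`», multiplicity one). [cite: Milne1999LefschetzClasses, Cor. 4.7 (p. 660) and §4 p. 658] -/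
theorem exists_lefschetzGroup_mulEquiv_of_isIsogenous_biproduct_of_forall {X : AbelianVariety ℂ}
    (A : Fin (n + 1) → AbelianVariety ℂ) (T : Fin (n + 1) → Type u) [∀ i, Group (T i)]
    (hOrth : ∀ i j, i ≠ j → ∀ f : A i ⟶ A j, f = 0) (h1 : ∀ i, 1 ≤ (A i).dim)
    (hcoord : ∀ i, ∃ e : lefschetzGroup (A i).dim (A i).X ≃* T i × ℂˣ,
      (∀ s : lefschetzGroup (A i).dim (A i).X, s.1 ∈ specialLefschetzGroup (A i).dim (A i).X → (e s).2 = 1) ∧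
      ∀ c : ℂˣ, (e ⟨weightCocharacter (A i).X c, weightCocharacter_mem_lefschetzGroup c⟩).2 = c ^ 2)
    (hX : AbelianVariety.IsIsogenous X (⨁ A)) :
    ∃ e : lefschetzGroup X.dim X.X ≃* (∀ i, T i) × ℂˣ,
      (∀ s : lefschetzGroup X.dim X.X, s.1 ∈ specialLefschetzGroup X.dim X.X → (e s).2 = 1) ∧
      ∀ c : ℂˣ, (e ⟨weightCocharacter X.X c, weightCocharacter_mem_lefschetzGroup c⟩).2 = c ^ 2 := by
  obtain ⟨e, he1, he2⟩ := exists_lefschetzGroup_biproduct_mulEquiv_of_forall A T hOrth h1 hcoord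
  exact exists_lefschetzGroup_mulEquiv_of_isIsogenous_of_mulEquiv hX e he1 he2

/-- **Cor. 4.7 with multiplicities, in torus coordinates: `(L(⨁ᵢ Aᵢ^{rᵢ+1}), l) ≅ ∏ᵢ (L(Aᵢ), l)`** — torus coordinates with
character on pairwise Hom-orthogonal positive-dimensional `Aᵢ` give `L(⨁ᵢ Aᵢ^{rᵢ+1})(ℂ) ≃* (∏ᵢ Tᵢ) × ℂˣ` with character
(powers do not change `(L, l)`; `Hom(Aᵢ^{r+1}, Aⱼ^{s+1}) = 0`). [cite: Milne1999LefschetzClasses, Prop. 1.5 (p. 644) and Cor. 4.7 (p. 660)] -/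
theorem exists_lefschetzGroup_biproduct_powSucc_mulEquiv_of_forall (A : Fin (n + 1) → AbelianVariety ℂ)
    (r : Fin (n + 1) → ℕ) (T : Fin (n + 1) → Type u) [∀ i, Group (T i)]
    (hOrth : ∀ i j, i ≠ j → ∀ f : A i ⟶ A j, f = 0) (h1 : ∀ i, 1 ≤ (A i).dim)
    (hcoord : ∀ i, ∃ e : lefschetzGroup (A i).dim (A i).X ≃* T i × ℂˣ,
      (∀ s : lefschetzGroup (A i).dim (A i).X, s.1 ∈ specialLefschetzGroup (A i).dim (A i).X → (e s).2 = 1) ∧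
      ∀ c : ℂˣ, (e ⟨weightCocharacter (A i).X c, weightCocharacter_mem_lefschetzGroup c⟩).2 = c ^ 2) :
    ∃ e : lefschetzGroup (⨁ fun i ↦ (A i).powSucc (r i)).dim (⨁ fun i ↦ (A i).powSucc (r i)).X ≃* (∀ i, T i) × ℂˣ,
      (∀ s : lefschetzGroup (⨁ fun i ↦ (A i).powSucc (r i)).dim (⨁ fun i ↦ (A i).powSucc (r i)).X,
        s.1 ∈ specialLefschetzGroup (⨁ fun i ↦ (A i).powSucc (r i)).dim (⨁ fun i ↦ (A i).powSucc (r i)).X → (e s).2 = 1) ∧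
      ∀ c : ℂˣ, (e ⟨weightCocharacter (⨁ fun i ↦ (A i).powSucc (r i)).X c, weightCocharacter_mem_lefschetzGroup c⟩).2 =
        c ^ 2 :=
  exists_lefschetzGroup_biproduct_mulEquiv_of_forall (fun i ↦ (A i).powSucc (r i)) T
    (fun i j hij ↦ hom_powSucc_eq_zero_of_forall_hom_eq_zero (hOrth i j hij) (r i) (r j))
    (fun i ↦ dim_powSucc_pos (h1 i) (r i)) fun i ↦ by
      obtain ⟨e, he1, he2⟩ := hcoord i
      exact exists_lefschetzGroup_powSucc_mulEquiv_of_mulEquiv (h1 i) (r i) e he1 he2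

/-- **Cor. 4.7 verbatim shape, in torus coordinates**: «an isogeny `A → A₁^{r₁} × ⋯ × A_s^{r_s}` with the `Aᵢ` […] pairwise
[Hom-orthogonal] defines an isomorphism `(L(A), l(A)) → ∏ᵢ (L(Aᵢ), l(Aᵢ))`» — for every `X ∼ ⨁ᵢ Aᵢ^{rᵢ+1}`,
`L(X)(ℂ) ≃* (∏ᵢ Tᵢ) × ℂˣ` with character. [cite: Milne1999LefschetzClasses, Cor. 4.7 (p. 660) and §4 p. 658] -/
theorem exists_lefschetzGroup_mulEquiv_of_isIsogenous_biproduct_powSucc_of_forall {X : AbelianVariety ℂ}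
    (A : Fin (n + 1) → AbelianVariety ℂ) (r : Fin (n + 1) → ℕ) (T : Fin (n + 1) → Type u) [∀ i, Group (T i)]
    (hOrth : ∀ i j, i ≠ j → ∀ f : A i ⟶ A j, f = 0) (h1 : ∀ i, 1 ≤ (A i).dim)
    (hcoord : ∀ i, ∃ e : lefschetzGroup (A i).dim (A i).X ≃* T i × ℂˣ,
      (∀ s : lefschetzGroup (A i).dim (A i).X, s.1 ∈ specialLefschetzGroup (A i).dim (A i).X → (e s).2 = 1) ∧
      ∀ c : ℂˣ, (e ⟨weightCocharacter (A i).X c, weightCocharacter_mem_lefschetzGroup c⟩).2 = c ^ 2)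
    (hX : AbelianVariety.IsIsogenous X (⨁ fun i ↦ (A i).powSucc (r i))) :
    ∃ e : lefschetzGroup X.dim X.X ≃* (∀ i, T i) × ℂˣ,
      (∀ s : lefschetzGroup X.dim X.X, s.1 ∈ specialLefschetzGroup X.dim X.X → (e s).2 = 1) ∧
      ∀ c : ℂˣ, (e ⟨weightCocharacter X.X c, weightCocharacter_mem_lefschetzGroup c⟩).2 = c ^ 2 := by
  obtain ⟨e, he1, he2⟩ := exists_lefschetzGroup_biproduct_powSucc_mulEquiv_of_forall A r T hOrth h1 hcoord
  exact exists_lefschetzGroup_mulEquiv_of_isIsogenous_of_mulEquiv hX e he1 he2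

end Biproduct

/-! ### §3 Milne 1999b Thm. 2.6 on `ℂ`-points: `L(⨁ A_Ψ)(ℂ) ≅ ∏_Ψ T^Ψ(ℂ)`, i.e. `≃* (∏ᵢ (Φᵢ → ℂˣ)) × ℂˣ` -/

section CM

variable {n : ℕ} {K : Fin (n + 1) → Type} [∀ i, Field (K i)] [∀ i, NumberField (K i)] [∀ i, IsCMField (K i)]
  {Φ : ∀ i, CMType (K i)} {A : Fin (n + 1) → AbelianVariety ℂ} {ι : ∀ i, 𝓞 (K i) →+* End (A i)}
  {θ : ∀ i, K i →+* Module.End ℂ (complexBetti (A i).X 1)} {X : AbelianVariety ℂ}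

omit [∀ i, IsCMField (K i)] in
/-- A realisation has positive dimension. [folklore] -/
private theorem one_le_dim_of_realisation (hA : ∀ i, IsCMTypeRealisation (Φ i) (A i) (ι i) (θ i)) (i : Fin (n + 1)) :
    1 ≤ (A i).dim := by
  have h1 := AbelianVariety.finrank_complexBetti_one (A i)
  rw [(hA i).2.1] at h1
  have h2 : 0 < Module.finrank ℚ (K i) := Module.finrank_pos
  omega

/-- **The CM coordinates of the factors are torus coordinates with character** (from `Milne1999/LefschetzGroupCMProducts`):
`L(Aᵢ)(ℂ) ≃* (Φᵢ → ℂˣ) × ℂˣ`, last coordinate `1` exactly on `ker l`, `(c, c²)` at `w(c)`. [cite: Milne1999, §2 Prop. 2.5] -/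
theorem exists_lefschetzGroup_mulEquiv_pi_units_prod_character (hA : ∀ i, IsCMTypeRealisation (Φ i) (A i) (ι i) (θ i))
    (hθ : ∀ (i) (a : K i), θ i a ∈ centralizerAlgebra (A i)) (i : Fin (n + 1)) :
    ∃ e : lefschetzGroup (A i).dim (A i).X ≃* ((Φ i).1 → ℂˣ) × ℂˣ,
      (∀ s : lefschetzGroup (A i).dim (A i).X, s.1 ∈ specialLefschetzGroup (A i).dim (A i).X → (e s).2 = 1) ∧
      ∀ c : ℂˣ, (e ⟨weightCocharacter (A i).X c, weightCocharacter_mem_lefschetzGroup c⟩).2 = c ^ 2 := by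
  obtain ⟨v, hv, -⟩ := Deligne1982.exists_eigenbasis_of_isCMTypeRealisation (hA i)
  obtain ⟨e, -, -, -, -, h5, h6⟩ := exists_lefschetzGroup_mulEquiv_pi_units_prod_apply_basis (hA i) (hθ i) hv
  exact ⟨e, fun s hs ↦ (h5 s).2 hs, fun c ↦ by rw [h6]⟩

/-- **Milne 1999b Thm. 2.6 on `ℂ`-points — `(L(⨁ A_Ψ), l) = ∏_Ψ (T^Ψ, t^Ψ)`**: for pairwise Hom-orthogonal realisations
`Aᵢ` of CM types `(Kᵢ; Φᵢ)` (`θᵢ(Kᵢ) ⊆ C(Aᵢ)`), **`L(⨁ Aᵢ)(ℂ) ≃* (∏ᵢ (Φᵢ → ℂˣ)) × ℂˣ`** with last coordinate Milne's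
character: `= 1` exactly on `ker l`, `c²` at `w(c)`, and the multiplier of `g₁` for EVERY polarization class of `⨁ Aᵢ` —
the torus `T^K(ℂ) = ∏_Ψ T^Ψ(ℂ)` of the CM algebra `∏ Kᵢ` fibred over `t`, of rank `Σ |Φᵢ| + 1 = dim + 1`.
[cite: Milne1999, §2 Prop. 2.5, Thm. 2.6 and its proof, A.7] [cite: Milne1999LefschetzClasses, Def. 4.6, Cor. 4.7 (p. 660)] -/
theorem exists_lefschetzGroup_biproduct_mulEquiv_pi_pi_units_prod (hA : ∀ i, IsCMTypeRealisation (Φ i) (A i) (ι i) (θ i))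
    (hθ : ∀ (i) (a : K i), θ i a ∈ centralizerAlgebra (A i)) (hOrth : ∀ i j, i ≠ j → ∀ f : A i ⟶ A j, f = 0) :
    ∃ e : lefschetzGroup (⨁ A).dim (⨁ A).X ≃* (∀ i, (Φ i).1 → ℂˣ) × ℂˣ,
      (∀ s : lefschetzGroup (⨁ A).dim (⨁ A).X, (e s).2 = 1 ↔ s.1 ∈ specialLefschetzGroup (⨁ A).dim (⨁ A).X) ∧
      (∀ c : ℂˣ, (e ⟨weightCocharacter (⨁ A).X c, weightCocharacter_mem_lefschetzGroup c⟩).2 = c ^ 2) ∧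
      ∀ {h : complexBetti (⨁ A).X 2}, IsPolarizationClass (⨁ A).dim (⨁ A).X h →
        ∀ (g : lefschetzGroup (⨁ A).dim (⨁ A).X) (x y : complexBetti (⨁ A).X 1),
          polarizationPairingOne (⨁ A).X h ((⨁ A).dim - 1) (g.1 1 x) (g.1 1 y) =
            (((e g).2 : ℂˣ) : ℂ) • polarizationPairingOne (⨁ A).X h ((⨁ A).dim - 1) x y := by
  have hd := one_le_dim_biproduct A (one_le_dim_of_realisation hA 0)
  obtain ⟨e, he1, he2⟩ := exists_lefschetzGroup_biproduct_mulEquiv_of_forall A (fun i ↦ (Φ i).1 → ℂˣ) hOrth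
    (one_le_dim_of_realisation hA) (exists_lefschetzGroup_mulEquiv_pi_units_prod_character hA hθ)
  exact ⟨e, snd_eq_one_iff_mem_specialLefschetzGroup_of_mulEquiv hd e he1 he2, he2,
    fun hpol g x y ↦ polarizationPairingOne_eq_snd_smul_of_mulEquiv hd e he1 he2 hpol g x y⟩

/-- **`L(⨁ Aᵢ)(ℂ) ≃* (∏ᵢ (Φᵢ → ℂˣ)) × ℂˣ`** as abstract groups (pairwise Hom-orthogonal CM realisations).
[cite: Milne1999, §2 Thm. 2.6] [cite: Milne1999LefschetzClasses, Cor. 4.7 (p. 660)] -/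
theorem nonempty_lefschetzGroup_biproduct_mulEquiv_pi_pi_units_prod (hA : ∀ i, IsCMTypeRealisation (Φ i) (A i) (ι i) (θ i))
    (hθ : ∀ (i) (a : K i), θ i a ∈ centralizerAlgebra (A i)) (hOrth : ∀ i j, i ≠ j → ∀ f : A i ⟶ A j, f = 0) :
    Nonempty (lefschetzGroup (⨁ A).dim (⨁ A).X ≃* (∀ i, (Φ i).1 → ℂˣ) × ℂˣ) := by
  obtain ⟨e, -⟩ := exists_lefschetzGroup_biproduct_mulEquiv_pi_pi_units_prod hA hθ hOrth
  exact ⟨e⟩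

/-- **`ker l(⨁ Aᵢ)(ℂ) ≃* ∏ᵢ (Φᵢ → ℂˣ)` — Prop. 1.5 «`S(A) ≅ ∏ S(Aᵢ)`» with Prop. 2.5 on each factor**, for pairwise
Hom-orthogonal CM realisations: the kernel `ker t^K` of the character, a torus of rank `Σ |Φᵢ| = dim ⨁ Aᵢ`.
[cite: Milne1999LefschetzClasses, Prop. 1.5 (p. 644) and §4 p. 659 (ker l = S)] [cite: Milne1999, §2 Prop. 2.5 and Thm. 2.6] -/
theorem nonempty_specialLefschetzGroup_biproduct_mulEquiv_pi_pi_units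
    (hA : ∀ i, IsCMTypeRealisation (Φ i) (A i) (ι i) (θ i)) (hθ : ∀ (i) (a : K i), θ i a ∈ centralizerAlgebra (A i))
    (hOrth : ∀ i j, i ≠ j → ∀ f : A i ⟶ A j, f = 0) :
    Nonempty (specialLefschetzGroup (⨁ A).dim (⨁ A).X ≃* ∀ i, (Φ i).1 → ℂˣ) := by
  obtain ⟨e, he1, he2⟩ := exists_lefschetzGroup_biproduct_mulEquiv_of_forall A (fun i ↦ (Φ i).1 → ℂˣ) hOrth
    (one_le_dim_of_realisation hA) (exists_lefschetzGroup_mulEquiv_pi_units_prod_character hA hθ)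
  obtain ⟨e', -⟩ := exists_specialLefschetzGroup_mulEquiv_of_mulEquiv
    (one_le_dim_biproduct A (one_le_dim_of_realisation hA 0)) e he1 he2
  exact ⟨e'⟩

/-- **`L(X)(ℂ) ≃* (∏ᵢ (Φᵢ → ℂˣ)) × ℂˣ` with character for every `X ∼ ⨁ Aᵢ`** (pairwise Hom-orthogonal CM realisations): the
last coordinate is `1` exactly on `ker l(X)`, `c²` at `w(c)`, and the multiplier for every polarization class of `X`.
[cite: Milne1999, §2 Thm. 2.6] [cite: Milne1999LefschetzClasses, Cor. 4.7 (p. 660) and §4 p. 658] -/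
theorem exists_lefschetzGroup_mulEquiv_pi_pi_units_prod_of_isIsogenous_biproduct
    (hA : ∀ i, IsCMTypeRealisation (Φ i) (A i) (ι i) (θ i)) (hθ : ∀ (i) (a : K i), θ i a ∈ centralizerAlgebra (A i))
    (hOrth : ∀ i j, i ≠ j → ∀ f : A i ⟶ A j, f = 0) (hX : AbelianVariety.IsIsogenous X (⨁ A)) :
    ∃ e : lefschetzGroup X.dim X.X ≃* (∀ i, (Φ i).1 → ℂˣ) × ℂˣ,
      (∀ s : lefschetzGroup X.dim X.X, (e s).2 = 1 ↔ s.1 ∈ specialLefschetzGroup X.dim X.X) ∧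
      (∀ c : ℂˣ, (e ⟨weightCocharacter X.X c, weightCocharacter_mem_lefschetzGroup c⟩).2 = c ^ 2) ∧
      ∀ {h : complexBetti X.X 2}, IsPolarizationClass X.dim X.X h →
        ∀ (g : lefschetzGroup X.dim X.X) (x y : complexBetti X.X 1),
          polarizationPairingOne X.X h (X.dim - 1) (g.1 1 x) (g.1 1 y) =
            (((e g).2 : ℂˣ) : ℂ) • polarizationPairingOne X.X h (X.dim - 1) x y := by
  have hX1 : 1 ≤ X.dim := by
    obtain ⟨f, hf⟩ := hX
    rw [AbelianVariety.dim_eq_of_isIsogeny hf]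
    exact one_le_dim_biproduct A (one_le_dim_of_realisation hA 0)
  obtain ⟨e, he1, he2⟩ := exists_lefschetzGroup_mulEquiv_of_isIsogenous_biproduct_of_forall A (fun i ↦ (Φ i).1 → ℂˣ)
    hOrth (one_le_dim_of_realisation hA) (exists_lefschetzGroup_mulEquiv_pi_units_prod_character hA hθ) hX
  exact ⟨e, snd_eq_one_iff_mem_specialLefschetzGroup_of_mulEquiv hX1 e he1 he2, he2,
    fun hpol g x y ↦ polarizationPairingOne_eq_snd_smul_of_mulEquiv hX1 e he1 he2 hpol g x y⟩

/-- `L(X)(ℂ) ≃* (∏ᵢ (Φᵢ → ℂˣ)) × ℂˣ` and `ker l(X)(ℂ) ≃* ∏ᵢ (Φᵢ → ℂˣ)` as abstract groups for every `X ∼ ⨁ Aᵢ`.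
[cite: Milne1999, §2 Thm. 2.6] [cite: Milne1999LefschetzClasses, Prop. 1.5 and Cor. 4.7 (p. 660)] -/
theorem nonempty_lefschetzGroup_mulEquiv_pi_pi_units_prod_of_isIsogenous_biproduct
    (hA : ∀ i, IsCMTypeRealisation (Φ i) (A i) (ι i) (θ i)) (hθ : ∀ (i) (a : K i), θ i a ∈ centralizerAlgebra (A i))
    (hOrth : ∀ i j, i ≠ j → ∀ f : A i ⟶ A j, f = 0) (hX : AbelianVariety.IsIsogenous X (⨁ A)) :
    Nonempty (lefschetzGroup X.dim X.X ≃* (∀ i, (Φ i).1 → ℂˣ) × ℂˣ) ∧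
      Nonempty (specialLefschetzGroup X.dim X.X ≃* ∀ i, (Φ i).1 → ℂˣ) := by
  have hX1 : 1 ≤ X.dim := by
    obtain ⟨f, hf⟩ := hX
    rw [AbelianVariety.dim_eq_of_isIsogeny hf]
    exact one_le_dim_biproduct A (one_le_dim_of_realisation hA 0)
  obtain ⟨e, he1, he2⟩ := exists_lefschetzGroup_mulEquiv_of_isIsogenous_biproduct_of_forall A (fun i ↦ (Φ i).1 → ℂˣ)
    hOrth (one_le_dim_of_realisation hA) (exists_lefschetzGroup_mulEquiv_pi_units_prod_character hA hθ) hX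
  obtain ⟨e', -⟩ := exists_specialLefschetzGroup_mulEquiv_of_mulEquiv hX1 e he1 he2
  exact ⟨⟨e⟩, ⟨e'⟩⟩

/-- **Pairwise non-isogenous SIMPLE CM abelian varieties** (the verbatim shape of Thm. 2.6 / Cor. 4.7, multiplicity one):
Hom-orthogonality is automatic (a non-zero homomorphism of simple abelian varieties is an isogeny), so
`L(X)(ℂ) ≃* (∏ᵢ (Φᵢ → ℂˣ)) × ℂˣ` and `ker l(X)(ℂ) ≃* ∏ᵢ (Φᵢ → ℂˣ)` for every `X ∼ ⨁ Aᵢ`.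
[cite: MumfordAV1970, §19 Cor. 2 of Thm. 1 (p. 174)] [cite: Milne1999, §2 Thm. 2.6] [cite: Milne1999LefschetzClasses, Cor. 4.7 (p. 660)] -/
theorem nonempty_lefschetzGroup_mulEquiv_pi_pi_units_prod_of_isSimple_of_isIsogenous_biproduct
    (hA : ∀ i, IsCMTypeRealisation (Φ i) (A i) (ι i) (θ i)) (hθ : ∀ (i) (a : K i), θ i a ∈ centralizerAlgebra (A i))
    (hS : ∀ i, AbelianVariety.IsSimple (A i)) (hn : ∀ i j, i ≠ j → ¬ AbelianVariety.IsIsogenous (A i) (A j))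
    (hX : AbelianVariety.IsIsogenous X (⨁ A)) :
    Nonempty (lefschetzGroup X.dim X.X ≃* (∀ i, (Φ i).1 → ℂˣ) × ℂˣ) ∧
      Nonempty (specialLefschetzGroup X.dim X.X ≃* ∀ i, (Φ i).1 → ℂˣ) :=
  nonempty_lefschetzGroup_mulEquiv_pi_pi_units_prod_of_isIsogenous_biproduct hA hθ
    (fun i j hij ↦ hom_eq_zero_of_isSimple_of_not_isIsogenous (hS i) (hS j) (hn i j hij)) hX

/-- `L(X)(ℂ)` is commutative for every `X ∼ ⨁ Aᵢ` (pairwise Hom-orthogonal CM realisations): a torus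
(cf. `lefschetzGroup_comm_iff_isOfCMType`). [cite: Milne1999, §1 Rem. 1.10 («π(A) is commutative») and §2 Thm. 2.6] -/
theorem lefschetzGroup_comm_of_isIsogenous_biproduct (hA : ∀ i, IsCMTypeRealisation (Φ i) (A i) (ι i) (θ i))
    (hθ : ∀ (i) (a : K i), θ i a ∈ centralizerAlgebra (A i)) (hOrth : ∀ i j, i ≠ j → ∀ f : A i ⟶ A j, f = 0)
    (hX : AbelianVariety.IsIsogenous X (⨁ A)) {g g' : ∀ k : ℕ, complexBetti X.X k ≃ₗ[ℂ] complexBetti X.X k}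
    (hg : g ∈ lefschetzGroup X.dim X.X) (hg' : g' ∈ lefschetzGroup X.dim X.X) : g * g' = g' * g := by
  obtain ⟨⟨e⟩, -⟩ := nonempty_lefschetzGroup_mulEquiv_pi_pi_units_prod_of_isIsogenous_biproduct hA hθ hOrth hX
  have h := mul_comm (e ⟨g, hg⟩) (e ⟨g', hg'⟩)
  rw [← map_mul, ← map_mul] at h
  exact congrArg Subtype.val (e.injective h)

/-- **«`L(A) ⊃ Hg(A)`» on the CM torus of a finite product**: `MT(X)(ℂ)` embeds in `(∏ᵢ (Φᵢ → ℂˣ)) × ℂˣ` for every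
`X ∼ ⨁ Aᵢ` (Deligne's «the Mumford–Tate group of `A` is contained in `E^×`» for the CM algebra `E = ∏ Kᵢ`), hence is commutative.
[cite: Milne1999LefschetzClasses, §4 p. 660 (L(A) ⊃ Hg(A)) and Cor. 4.7] [cite: Deligne1982HodgeCycles, I §5 proof of Prop. 5.1] -/
theorem exists_injective_monoidHom_mumfordTateGroup_pi_pi_units_prod_of_isIsogenous_biproduct
    (hA : ∀ i, IsCMTypeRealisation (Φ i) (A i) (ι i) (θ i)) (hθ : ∀ (i) (a : K i), θ i a ∈ centralizerAlgebra (A i))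
    (hOrth : ∀ i j, i ≠ j → ∀ f : A i ⟶ A j, f = 0) (hX : AbelianVariety.IsIsogenous X (⨁ A)) :
    ∃ f : mumfordTateGroup X.dim X.X →* (∀ i, (Φ i).1 → ℂˣ) × ℂˣ, Function.Injective f := by
  obtain ⟨⟨e⟩, -⟩ := nonempty_lefschetzGroup_mulEquiv_pi_pi_units_prod_of_isIsogenous_biproduct hA hθ hOrth hX
  exact ⟨e.toMonoidHom.comp (Subgroup.inclusion X.hodgeGroup_le_specialLefschetzGroup.2),
    e.injective.comp (Subgroup.inclusion_injective _)⟩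

/-- `MT(X)(ℂ)` is commutative for every `X ∼ ⨁ Aᵢ` (pairwise Hom-orthogonal CM realisations).
[cite: Deligne1982HodgeCycles, I §5 proof of Prop. 5.1] [cite: Milne1999LefschetzClasses, §4 p. 660] -/
theorem mumfordTateGroup_comm_of_isIsogenous_biproduct (hA : ∀ i, IsCMTypeRealisation (Φ i) (A i) (ι i) (θ i))
    (hθ : ∀ (i) (a : K i), θ i a ∈ centralizerAlgebra (A i)) (hOrth : ∀ i j, i ≠ j → ∀ f : A i ⟶ A j, f = 0)
    (hX : AbelianVariety.IsIsogenous X (⨁ A)) {g g' : ∀ k : ℕ, complexBetti X.X k ≃ₗ[ℂ] complexBetti X.X k}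
    (hg : g ∈ mumfordTateGroup X.dim X.X) (hg' : g' ∈ mumfordTateGroup X.dim X.X) : g * g' = g' * g := by
  obtain ⟨f, hf⟩ := exists_injective_monoidHom_mumfordTateGroup_pi_pi_units_prod_of_isIsogenous_biproduct hA hθ hOrth hX
  have h := mul_comm (f ⟨g, hg⟩) (f ⟨g', hg'⟩)
  rw [← map_mul, ← map_mul] at h
  exact congrArg Subtype.val (hf h)

/-- **`MT(X)(ℂ) ≃* (∏ᵢ (Φᵢ → ℂˣ)) × ℂˣ` and `Hg′(X)(ℂ) ≃* ∏ᵢ (Φᵢ → ℂˣ)` when `X ∼ ⨁ Aᵢ` is STABLY NONDEGENERATE**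
(Prop. 4.8 (a) ⟹ (b), (c): `MT = L`, `Hg′ = ker l`): the Mumford–Tate group fills the torus `∏_Ψ T^Ψ(ℂ)`.
[cite: Milne1999LefschetzClasses, Prop. 4.8 (p. 660) and Cor. 4.7] [cite: Gordon1999HodgeAVSurvey, Thm. 7.5 and Def. 7.6]
[cite: Milne1999, §2 Thm. 2.6] -/
theorem nonempty_mumfordTateGroup_mulEquiv_pi_pi_units_prod_of_isStablyNondegenerate
    (hA : ∀ i, IsCMTypeRealisation (Φ i) (A i) (ι i) (θ i)) (hθ : ∀ (i) (a : K i), θ i a ∈ centralizerAlgebra (A i))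
    (hOrth : ∀ i j, i ≠ j → ∀ f : A i ⟶ A j, f = 0) (hX : AbelianVariety.IsIsogenous X (⨁ A))
    (hS : IsStablyNondegenerate X) :
    Nonempty (mumfordTateGroup X.dim X.X ≃* (∀ i, (Φ i).1 → ℂˣ) × ℂˣ) ∧
      Nonempty (hodgeGroup X.dim X.X ≃* ∀ i, (Φ i).1 → ℂˣ) := by
  have hX1 : 1 ≤ X.dim := by
    obtain ⟨f, hf⟩ := hX
    rw [AbelianVariety.dim_eq_of_isIsogeny hf]
    exact one_le_dim_biproduct A (one_le_dim_of_realisation hA 0)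
  obtain ⟨⟨e⟩, ⟨e'⟩⟩ := nonempty_lefschetzGroup_mulEquiv_pi_pi_units_prod_of_isIsogenous_biproduct hA hθ hOrth hX
  exact ⟨⟨(MulEquiv.subgroupCongr ((X.mumfordTateGroup_eq_lefschetzGroup_iff_forall_isDivisorGenerated hX1).2 hS)).trans e⟩,
    ⟨(MulEquiv.subgroupCongr (X.hodgeGroup_eq_specialLefschetzGroup_iff_forall_isDivisorGenerated.2 hS)).trans e'⟩⟩

/-- **Thm. 2.6 / Cor. 4.7 with multiplicities: `L(X)(ℂ) ≃* (∏ᵢ (Φᵢ → ℂˣ)) × ℂˣ` with character for every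
`X ∼ ⨁ᵢ Aᵢ^{rᵢ+1}`** (pairwise Hom-orthogonal CM realisations `Aᵢ` of `(Kᵢ; Φᵢ)`): last coordinate `1` exactly on `ker l(X)`,
`c²` at `w(c)`, the multiplier for every polarization class of `X`. [cite: Milne1999, §2 Thm. 2.6 and Prop. 2.5]
[cite: Milne1999LefschetzClasses, Cor. 4.7 (p. 660)] -/
theorem exists_lefschetzGroup_mulEquiv_pi_pi_units_prod_of_isIsogenous_biproduct_powSucc
    (hA : ∀ i, IsCMTypeRealisation (Φ i) (A i) (ι i) (θ i)) (hθ : ∀ (i) (a : K i), θ i a ∈ centralizerAlgebra (A i))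
    (hOrth : ∀ i j, i ≠ j → ∀ f : A i ⟶ A j, f = 0) (r : Fin (n + 1) → ℕ)
    (hX : AbelianVariety.IsIsogenous X (⨁ fun i ↦ (A i).powSucc (r i))) :
    ∃ e : lefschetzGroup X.dim X.X ≃* (∀ i, (Φ i).1 → ℂˣ) × ℂˣ,
      (∀ s : lefschetzGroup X.dim X.X, (e s).2 = 1 ↔ s.1 ∈ specialLefschetzGroup X.dim X.X) ∧
      (∀ c : ℂˣ, (e ⟨weightCocharacter X.X c, weightCocharacter_mem_lefschetzGroup c⟩).2 = c ^ 2) ∧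
      ∀ {h : complexBetti X.X 2}, IsPolarizationClass X.dim X.X h →
        ∀ (g : lefschetzGroup X.dim X.X) (x y : complexBetti X.X 1),
          polarizationPairingOne X.X h (X.dim - 1) (g.1 1 x) (g.1 1 y) =
            (((e g).2 : ℂˣ) : ℂ) • polarizationPairingOne X.X h (X.dim - 1) x y := by
  have hX1 : 1 ≤ X.dim := by
    obtain ⟨f, hf⟩ := hX
    rw [AbelianVariety.dim_eq_of_isIsogeny hf]
    exact one_le_dim_biproduct _ (dim_powSucc_pos (one_le_dim_of_realisation hA 0) (r 0))
  obtain ⟨e, he1, he2⟩ := exists_lefschetzGroup_mulEquiv_of_isIsogenous_biproduct_powSucc_of_forall A r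
    (fun i ↦ (Φ i).1 → ℂˣ) hOrth (one_le_dim_of_realisation hA) (exists_lefschetzGroup_mulEquiv_pi_units_prod_character hA hθ)
    hX
  exact ⟨e, snd_eq_one_iff_mem_specialLefschetzGroup_of_mulEquiv hX1 e he1 he2, he2,
    fun hpol g x y ↦ polarizationPairingOne_eq_snd_smul_of_mulEquiv hX1 e he1 he2 hpol g x y⟩

/-- `L(X)(ℂ) ≃* (∏ᵢ (Φᵢ → ℂˣ)) × ℂˣ` and `ker l(X)(ℂ) ≃* ∏ᵢ (Φᵢ → ℂˣ)` for every `X ∼ ⨁ᵢ Aᵢ^{rᵢ+1}` (pairwise Hom-orthogonal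
CM realisations; abstract groups) — in particular for `X` isogenous to a product of powers of pairwise non-isogenous SIMPLE CM
abelian varieties (`hom_eq_zero_of_isSimple_of_not_isIsogenous`). [cite: Milne1999, §2 Thm. 2.6]
[cite: Milne1999LefschetzClasses, Prop. 1.5 (p. 644) and Cor. 4.7 (p. 660)] -/
theorem nonempty_lefschetzGroup_mulEquiv_pi_pi_units_prod_of_isIsogenous_biproduct_powSucc
    (hA : ∀ i, IsCMTypeRealisation (Φ i) (A i) (ι i) (θ i)) (hθ : ∀ (i) (a : K i), θ i a ∈ centralizerAlgebra (A i))
    (hOrth : ∀ i j, i ≠ j → ∀ f : A i ⟶ A j, f = 0) (r : Fin (n + 1) → ℕ)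
    (hX : AbelianVariety.IsIsogenous X (⨁ fun i ↦ (A i).powSucc (r i))) :
    Nonempty (lefschetzGroup X.dim X.X ≃* (∀ i, (Φ i).1 → ℂˣ) × ℂˣ) ∧
      Nonempty (specialLefschetzGroup X.dim X.X ≃* ∀ i, (Φ i).1 → ℂˣ) := by
  have hX1 : 1 ≤ X.dim := by
    obtain ⟨f, hf⟩ := hX
    rw [AbelianVariety.dim_eq_of_isIsogeny hf]
    exact one_le_dim_biproduct _ (dim_powSucc_pos (one_le_dim_of_realisation hA 0) (r 0))
  obtain ⟨e, he1, he2⟩ := exists_lefschetzGroup_mulEquiv_of_isIsogenous_biproduct_powSucc_of_forall A r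
    (fun i ↦ (Φ i).1 → ℂˣ) hOrth (one_le_dim_of_realisation hA) (exists_lefschetzGroup_mulEquiv_pi_units_prod_character hA hθ)
    hX
  obtain ⟨e', -⟩ := exists_specialLefschetzGroup_mulEquiv_of_mulEquiv hX1 e he1 he2
  exact ⟨⟨e⟩, ⟨e'⟩⟩

/-- **One CM factor and its powers: `L(X)(ℂ) ≃* (Φ → ℂˣ) × ℂˣ` with character for every `X ∼ A^{r+1}`**, `A` a realisation
of `(K; Φ)` with `θ(K) ⊆ C(A)` (Prop. 2.5 with «`S(A) = S(A^r)`» / Cor. 4.7 for one isogeny type): last coordinate `1` exactly on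
`ker l(X)`, `c²` at `w(c)`, the multiplier for every polarization class of `X`. [cite: Milne1999, §2 Prop. 2.5]
[cite: Milne1999LefschetzClasses, Prop. 1.5 (p. 644) and Cor. 4.7 (p. 660)] -/
theorem exists_lefschetzGroup_mulEquiv_pi_units_prod_of_isIsogenous_powSucc {K₀ : Type} [Field K₀] [NumberField K₀]
    [IsCMField K₀] {Φ₀ : CMType K₀} {A₀ : AbelianVariety ℂ} {ι₀ : 𝓞 K₀ →+* End A₀}
    {θ₀ : K₀ →+* Module.End ℂ (complexBetti A₀.X 1)} (hA : IsCMTypeRealisation Φ₀ A₀ ι₀ θ₀)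
    (hθ : ∀ a : K₀, θ₀ a ∈ centralizerAlgebra A₀) (r : ℕ) (hX : AbelianVariety.IsIsogenous X (A₀.powSucc r)) :
    ∃ e : lefschetzGroup X.dim X.X ≃* (Φ₀.1 → ℂˣ) × ℂˣ,
      (∀ s : lefschetzGroup X.dim X.X, (e s).2 = 1 ↔ s.1 ∈ specialLefschetzGroup X.dim X.X) ∧
      (∀ c : ℂˣ, (e ⟨weightCocharacter X.X c, weightCocharacter_mem_lefschetzGroup c⟩).2 = c ^ 2) ∧
      ∀ {h : complexBetti X.X 2}, IsPolarizationClass X.dim X.X h →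
        ∀ (g : lefschetzGroup X.dim X.X) (x y : complexBetti X.X 1),
          polarizationPairingOne X.X h (X.dim - 1) (g.1 1 x) (g.1 1 y) =
            (((e g).2 : ℂˣ) : ℂ) • polarizationPairingOne X.X h (X.dim - 1) x y := by
  have hA1 : 1 ≤ A₀.dim := by
    have h1 := AbelianVariety.finrank_complexBetti_one A₀
    rw [hA.2.1] at h1
    have h2 : 0 < Module.finrank ℚ K₀ := Module.finrank_pos
    omega
  have hX1 : 1 ≤ X.dim := by
    obtain ⟨f, hf⟩ := hX
    rw [AbelianVariety.dim_eq_of_isIsogeny hf]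
    exact dim_powSucc_pos hA1 r
  obtain ⟨v, hv, -⟩ := Deligne1982.exists_eigenbasis_of_isCMTypeRealisation hA
  obtain ⟨e₀, -, -, -, -, h5, h6⟩ := exists_lefschetzGroup_mulEquiv_pi_units_prod_apply_basis hA hθ hv
  obtain ⟨eP, hP1, hP2⟩ := exists_lefschetzGroup_powSucc_mulEquiv_of_mulEquiv hA1 r e₀ (fun s hs ↦ (h5 s).2 hs)
    (fun c ↦ by rw [h6])
  obtain ⟨e, he1, he2⟩ := exists_lefschetzGroup_mulEquiv_of_isIsogenous_of_mulEquiv hX eP hP1 hP2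
  exact ⟨e, snd_eq_one_iff_mem_specialLefschetzGroup_of_mulEquiv hX1 e he1 he2, he2,
    fun hpol g x y ↦ polarizationPairingOne_eq_snd_smul_of_mulEquiv hX1 e he1 he2 hpol g x y⟩

end CM

end Literature.AlgebraicGeometry.Milne1999

end
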